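import Literature.MathematicalPhysics.QuantumFieldTheory.Balaban1983to89.Node00.TransportOfRecordGaugeAE
import HarnessLib

/-!
# `FluctuationComparisonRegPrIntLS1aInvariantVersion` — THE «ONE VERSION» DOOR FOR S1aᴴ's `∃ ρ`: every tower law of S1aᴴ's shape has a density that is
# GAUGE INVARIANT AT EVERY POINT, measurable, non-negative, continuous on the maximal regular set of its a.e.-class and pointwise-determined there; a.e. sandwiches
# with continuous bounds on open windows become POINTWISE for it (UV3-NODE §69.2 δ7 «a.e. → pointwise», δ11 «`Witness.gaugeInvariant`»)

Cell `ym3-torus` (HUMAN RULING D-0037: rung R3 = continuum SU(2) Yang–Mills on T³ — NOT d = 4, NOT infinite volume, NOT a mass gap, NOT Clay), WIDTH COPY «width 17»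
of ym3-torus-p1, seat `ym3-torus-px17` gen 20; `--kind proof --supports stmt-QuantumFields-20520 --as helper` (count-neutral).  THEOREMS ONLY (no `def`, no `sorry`,
no `instance`, no `notation`, default heartbeats).  Pen (a) of the seat's 10:21:40Z OFFER; «GO — YOURS» px8 g22 10:29:36Z (the (m2)-door lineage, UV3-NODE §69) with two
docking data honoured below: (1) the version lemmas are stated for an ARBITRARY open set and ARBITRARY continuous bounds on ANY lattice `GaugeField P j SU(N)` (so both
✓p819387's `heightDensity` sandwich at the height lattice and ✓p820217's (47′)∕(41′) exponentials at run-`K` level `k` plug in); (2) pointwise invariance is supplied on the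
lattice where the version lives (`readAtLevel` transports it, ✓`…gaugeInvariant_readAtLevel`).

WHY.  S1aᴴ `RunClassMembershipH` (`Lines/runpair_organ.lean` v18.4 :534) asks for ONE density `ρ j` per height carrying FIVE conjuncts at once — (p) window
positivity, (w) `μ j = dU_j.withDensity (ofReal ∘ ρ j)`, (m) class membership (whose `Witness` wants `Measurable`, `0 ≤`, `GaugeInvariant` POINTWISE and POINTWISE
(41)∕(47) on the window), (c) `ContinuousOn` the window, (a) analyticity.  Every density the tree constructs is an a.e.-defined object (Radon–Nikodym: lit
`T3RestrictedUnitDensity.resDensity`, `T3TiltDescent.heightDensity`; ✓p819880 `exists_densities` gives (w) + (p) on the plateau + an a.e. sandwich for SOME measurable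
version), and the (α)-socket's (41′)∕(47′) are a.e. rows (`Ineq41AE`∕`Ineq47AE`) — UV3-NODE §67.3 «VERSION: all later conjuncts need ONE pointwise version» and §69.2 δ7∕δ11.
THIS FILE names that version and proves what it carries, by porting BY NAME the pub-ymgap NODE 00 generic layer (`Node00.CanonicalTransportOfRecord`: `canonVersion`,
`regSet`, determinacy; `Node00.TransportOfRecordGaugeAE` §1: orbit averages in a.e. currency; `Node00.InvariantTransportOfRecord`'s construction `T♮ = canon ∘ orbAvg`,
there tied to the T⁴ transform of record, here for an arbitrary density) + ym3's own `T3OrbitAverage.orbAvg`∕`orbAvg_gaugeAct`∕`haarTransf`.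

CONTENT (the version is the explicit term `Node00.canonVersion dU (T3OrbitAverage.orbAvg ρ₀)` — no definition is introduced).
* §0 generic measure theory: `le_on_of_ae_le_of_continuousOn` (a.e. `≤` on an open set between functions continuous there is pointwise, open-positive measure);
  `measurable_piecewise_of_continuousOn`; `comp_ae_eq_of_map_withDensity_eq` (the density of a law invariant under a measure-preserving bijection is a.e. invariant).
* §1 on any `GaugeField P j SU(N)`: ★`gaugeInvariant_canonVersion_orbAvg` (pointwise, NO hypothesis); `measurable_orbAvg`, ★`measurable_canonVersion_orbAvg`;
  `comp_gaugeAct_ae_eq_of_map_withDensity_eq`; ★`canonVersion_orbAvg_ae_eq` (a version); ★`withDensity_canonVersion_orbAvg_eq` ((w) kept); ★`canonVersion_orbAvg_nonneg`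
  (pointwise); ★`canonVersion_orbAvg_eqOn_of_continuousOn` (determinacy on every open set with a continuous representative); `regSet_orbAvg_eq`;
  ★`continuousOn_canonVersion_orbAvg` (continuous on `regSet dU ρ₀`); ★`le_canonVersion_orbAvg_on` ∕ ★`canonVersion_orbAvg_le_on` (δ7: a.e. bounds by continuous functions on an
  open `U ⊆ regSet` are pointwise) and `canonVersion_orbAvg_pos_on` ((p) from a continuous positive a.e.-minorant).
* SIBLING FILE `…S1aTowerLawInvariance` (same seat): S1aᴴ's run and cut-tower laws ARE gauge-invariant measures, and the door in S1aᴴ's binders — from ANY measurable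
  non-negative density family `ρ₀` of the cut tower, the versions `ρ j := canonVersion dU_j (orbAvg (ρ₀ j))` carry all of §1 at once.

AS PRINTED vs AS TYPED (★p1 «every gap named»).  Print needs none of this: [Balaban1985Averaging] (10)–(13) p. 19 («T maps gauge-invariant densities to gauge-invariant
ones») is a sentence about the FORMULA `ρ′(V) = ∫ dU δ(VŪ⁻¹)ρ(U)`, and (41)∕(47) of [Balaban1985UV3] are inequalities between such formulas; the tree's densities are
a.e.-classes, so «one pointwise version carrying (p)(w)(m)(c) together» is a TYPED obligation, discharged here up to ONE displayed residual: «the `θ_j`-window lies in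
`Node00.regSet dU_j (ρ₀ j)`» — the window CONTINUITY CLASS of the FULL tower density (UV3-NODE §67.3 (c): typed for the `histGood`-restricted densities by ✓WREG, NOT for the
full marginal — the guard jump of the averaging cascade off `histGood`; unprinted; NOT asserted here).  Under that residual, (c) and δ7 and (p) (from WREG's continuous positive
minorant and ✓p819387's sandwich) are read on the version by §1; (m)'s analytic content and (a) are untouched.

HONEST FRAMING.  Measure-theoretic bookkeeping over Mathlib and landed tree facts; nothing of Bałaban's analysis is asserted or proved; S1a(ᴴ) — (m) AS TYPED misstated by
currency (★★OWNER RULING №80; repair (R-β1′) with the substrate), AS PRINTED OPEN; (c) for the full marginal, (a), 26243, S2β, `SpreadFibreLawH(J)(sq)`, the five registered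
stubs of `Lines/semiclassical_s2beta.lean`, crux 20520 ∕ 19936 ∕ 19200 and `YM3TorusSU2` are NOT proved; no registered stub is closed; registry untouched; rung R3 = SU(2) YM₃ on
T³ at fixed lattice data — NOT d = 4, NOT infinite volume, NOT a mass gap, NOT Clay; the Yang–Mills mass gap is NOT proved by any of this.
References: [Balaban1985Averaging] CMP 98 (1985) (10)–(13) p. 19; [Balaban1985UV3] CMP 102 (1985) (2) p. 256, (41) p. 266, (47) p. 267; [Balaban1987RG1] CMP 109 (1987)
(0.13) p. 254, (0.19) p. 255; [Balaban1989LargeFieldI] CMP 122 (1989) p. 176 (positivity of the densities).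
-/

set_option autoImplicit false

noncomputable section

namespace Summit.QuantumFields.YangMills.Theorems.FluctuationComparisonRegPrIntLS1aInvariantVersion

open MeasureTheory Filter Topology Set Function
open scoped ENNReal NNReal
open Literature.MathematicalPhysics.QuantumFieldTheory.Balaban1983to89
open Literature.MathematicalPhysics.QuantumFieldTheory.Balaban1983to89.Node00
  (canonVersion regSet HasContVersionOn canonVersion_ae_eq canonVersion_eq_of_not_mem continuousOn_canonVersion
   canonVersion_eqOn_of_continuousOn regSet_congr_ae subset_regSet isOpen_regSet canonVersion_comp_eqOn preimage_regSet_eq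
   orbAvg_ae_eq_of_ae_invariant' orbAvg_congr_ae measurable_gaugeAct_uncurry hasContVersionOn_regSet)
open Literature.MathematicalPhysics.QuantumFieldTheory.Balaban1983to89.T3OrbitAverage (haarTransf orbAvg orbAvg_gaugeAct)
open Literature.MathematicalPhysics.QuantumFieldTheory.Balaban1983to89.B12RTGaugeInvariance254
  (measurePreserving_gaugeAct measurable_gaugeAct invTransf gaugeAct_inv_gaugeAct gaugeAct_gaugeAct_inv)
open Literature.MathematicalPhysics.QuantumFieldTheory.Balaban1983to89.B12ContinuousTransportInvariance
  (continuous_gaugeAct_SU isOpenPosMeasure_fieldMeasure_SU)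
open scoped Literature.MathematicalPhysics.QuantumFieldTheory.Balaban1983to89.T3OrbitAverage

/-! ## §0 Three measure-theoretic lemmas (generic) -/

section Generic

variable {α : Type*} [TopologicalSpace α] [MeasurableSpace α]

/-- **A.E. ⇒ POINTWISE FOR CONTINUOUS FUNCTIONS ON AN OPEN SET** (open-positive measure): `f ≤ g` a.e. on an open `U` with `f, g` continuous on `U` gives `f ≤ g` at every
point of `U` — the set `{x ∈ U | g x < f x}` is open and null, hence empty. [folklore] -/
theorem le_on_of_ae_le_of_continuousOn [OpensMeasurableSpace α] {μ : Measure α} [μ.IsOpenPosMeasure] {U : Set α} (hU : IsOpen U)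
    {f g : α → ℝ} (hf : ContinuousOn f U) (hg : ContinuousOn g U) (h : ∀ᵐ x ∂μ.restrict U, f x ≤ g x) : ∀ x ∈ U, f x ≤ g x := by
  have hV : IsOpen (U ∩ (fun x => f x - g x) ⁻¹' Ioi 0) := (hf.sub hg).isOpen_inter_preimage hU isOpen_Ioi
  have h1 : μ.restrict U ((fun x => f x - g x) ⁻¹' Ioi 0) = 0 := by
    refine measure_eq_zero_iff_ae_notMem.2 ?_
    filter_upwards [h] with x hx
    simp only [mem_preimage, mem_Ioi, not_lt, sub_nonpos]
    exact hx
  have hV0 : μ (U ∩ (fun x => f x - g x) ⁻¹' Ioi 0) = 0 := by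
    rw [inter_comm, ← Measure.restrict_apply' hU.measurableSet]
    exact h1
  have hempty := (hV.measure_eq_zero_iff μ).1 hV0
  intro x hx
  by_contra hlt
  have hmem : x ∈ U ∩ (fun x => f x - g x) ⁻¹' Ioi 0 :=
    ⟨hx, by simp only [mem_preimage, mem_Ioi, sub_pos]; exact lt_of_not_ge hlt⟩
  rw [hempty] at hmem
  exact hmem

/-- **A PIECEWISE FUNCTION, CONTINUOUS ON AN OPEN PIECE AND MEASURABLE OFF IT, IS MEASURABLE**: `s.piecewise g f` for `s` open, `g` continuous on `s`, `f` measurable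
(Mathlib's `ContinuousOn.measurable_piecewise` asks `f` continuous on `sᶜ`; here `f` is only measurable). [folklore] -/
theorem measurable_piecewise_of_continuousOn [OpensMeasurableSpace α] {s : Set α} [∀ x, Decidable (x ∈ s)] (hs : IsOpen s)
    {g f : α → ℝ} (hg : ContinuousOn g s) (hf : Measurable f) : Measurable (s.piecewise g f) := by
  refine measurable_of_isOpen fun t ht => ?_
  rw [piecewise_preimage, Set.ite]
  apply MeasurableSet.union
  · rcases _root_.continuousOn_iff'.1 hg t ht with ⟨u, u_open, hu⟩
    rw [hu]
    exact u_open.measurableSet.inter hs.measurableSet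
  · exact (hf ht.measurableSet).diff hs.measurableSet

omit [TopologicalSpace α] in
/-- **THE DENSITY OF AN INVARIANT LAW IS A.E. INVARIANT**: if `Φ` is a measurable map preserving a σ-finite `μ` with a measurable left inverse `Ψ`, and the law
`μ.withDensity f` (`f` measurable) is `Φ`-invariant, then `f ∘ Φ = f` `μ`-a.e. (push the pulled-back density forward and compare densities, `withDensity_eq_iff_of_sigmaFinite`). [folklore] -/
theorem comp_ae_eq_of_map_withDensity_eq {μ : Measure α} [SigmaFinite μ] {Φ Ψ : α → α} (hΦm : Measurable Φ) (hΨm : Measurable Ψ)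
    (hΦ : MeasurePreserving Φ μ μ) (hΨΦ : ∀ x, Ψ (Φ x) = x)
    {f : α → ℝ≥0∞} (hf : Measurable f) (hinv : (μ.withDensity f).map Φ = μ.withDensity f) : f ∘ Φ =ᵐ[μ] f := by
  -- `(μ.withDensity ((f ∘ Ψ) ∘ Φ)).map Φ = (μ.map Φ).withDensity (f ∘ Ψ) = μ.withDensity (f ∘ Ψ)`, and `(f ∘ Ψ) ∘ Φ = f`
  have h1 : (μ.withDensity fun x => (f ∘ Ψ) (Φ x)).map Φ = (μ.map Φ).withDensity (f ∘ Ψ) := by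
    ext t ht
    rw [Measure.map_apply hΦm ht, withDensity_apply _ (hΦm ht), withDensity_apply _ ht, Measure.restrict_map hΦm ht,
      lintegral_map (hf.comp hΨm) hΦm]
  have h2 : (fun x => (f ∘ Ψ) (Φ x)) = f := funext fun x => by simp only [Function.comp_apply, hΨΦ]
  rw [h2, hΦ.map_eq, hinv] at h1
  -- densities of the same measure agree a.e.
  have h3 : f =ᵐ[μ] f ∘ Ψ := (withDensity_eq_iff_of_sigmaFinite hf.aemeasurable (hf.comp hΨm).aemeasurable).1 h1
  have h4 : f ∘ Φ =ᵐ[μ] (f ∘ Ψ) ∘ Φ := hΦ.quasiMeasurePreserving.ae_eq_comp h3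
  rw [show (f ∘ Ψ) ∘ Φ = f from funext fun x => by simp only [Function.comp_apply, hΨΦ]] at h4
  exact h4

end Generic

/-! ## §1 The Γ-averaged canonical version `canonVersion dU (orbAvg ρ₀)` of a density on `SU(N)^{bonds}` -/

section Gauge

variable {N : ℕ} [NeZero N] {P : Params} {j : ℕ}

/-- ★ **THE Γ-AVERAGED CANONICAL VERSION IS GAUGE INVARIANT AT EVERY POINT, FOR EVERY INPUT** — no measurability, no invariance hypothesis: the orbit average
`orbAvg ρ₀` is exactly invariant (ym3 ✓`T3OrbitAverage.orbAvg_gaugeAct`), so its maximal regular set is gauge-stable (Node00 ✓`preimage_regSet_eq`), the canonical version is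
invariant ON it (Node00 ✓`canonVersion_comp_eqOn`) and is `orbAvg ρ₀` verbatim OFF it (= pub-ymgap Node00's `TinvOfRecord_gaugeAct` with the transform of record replaced by an
arbitrary function). [cite: Balaban1985Averaging, (12)-(13) p.19] -/
theorem gaugeInvariant_canonVersion_orbAvg (ρ₀ : GaugeField P j (Matrix.specialUnitaryGroup (Fin N) ℂ) → ℝ) :
    GaugeField.GaugeInvariant
      (canonVersion (fieldMeasure P j (Matrix.specialUnitaryGroup (Fin N) ℂ)) (orbAvg ρ₀)) := by
  haveI : (fieldMeasure P j (Matrix.specialUnitaryGroup (Fin N) ℂ)).IsOpenPosMeasure := isOpenPosMeasure_fieldMeasure_SU N P j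
  haveI : SecondCountableTopology (GaugeField P j (Matrix.specialUnitaryGroup (Fin N) ℂ)) := T3OrbitAverage.instSecondCountableGaugeField
  haveI : BorelSpace (GaugeField P j (Matrix.specialUnitaryGroup (Fin N) ℂ)) := T3OrbitAverage.instBorelSpaceGaugeField
  intro v V
  have hΦc : Continuous (GaugeField.gaugeAct v :
      GaugeField P j (Matrix.specialUnitaryGroup (Fin N) ℂ) → GaugeField P j (Matrix.specialUnitaryGroup (Fin N) ℂ)) :=
    continuous_gaugeAct_SU N P j v
  have hΨc : Continuous (GaugeField.gaugeAct (invTransf v) :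
      GaugeField P j (Matrix.specialUnitaryGroup (Fin N) ℂ) → GaugeField P j (Matrix.specialUnitaryGroup (Fin N) ℂ)) :=
    continuous_gaugeAct_SU N P j (invTransf v)
  have hinv : (orbAvg ρ₀) ∘ GaugeField.gaugeAct v =ᵐ[fieldMeasure P j (Matrix.specialUnitaryGroup (Fin N) ℂ)] orbAvg ρ₀ :=
    Filter.Eventually.of_forall fun W => orbAvg_gaugeAct ρ₀ v W
  by_cases hV : V ∈ regSet (fieldMeasure P j (Matrix.specialUnitaryGroup (Fin N) ℂ)) (orbAvg ρ₀)
  · exact canonVersion_comp_eqOn (μ := fieldMeasure P j (Matrix.specialUnitaryGroup (Fin N) ℂ)) (f := orbAvg ρ₀) hΦc hΨc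
      (measurePreserving_gaugeAct v) (measurePreserving_gaugeAct (invTransf v)) (gaugeAct_inv_gaugeAct v) (gaugeAct_gaugeAct_inv v) hinv hV
  · have hpre := preimage_regSet_eq (μ := fieldMeasure P j (Matrix.specialUnitaryGroup (Fin N) ℂ)) (f := orbAvg ρ₀) hΦc hΨc
      (measurePreserving_gaugeAct v) (measurePreserving_gaugeAct (invTransf v)) (gaugeAct_inv_gaugeAct v) (gaugeAct_gaugeAct_inv v) hinv
    have hV' : GaugeField.gaugeAct v V ∉ regSet (fieldMeasure P j (Matrix.specialUnitaryGroup (Fin N) ℂ)) (orbAvg ρ₀) := by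
      intro hmem
      exact hV (by rw [← hpre]; exact hmem)
    rw [canonVersion_eq_of_not_mem hV', canonVersion_eq_of_not_mem hV]
    exact orbAvg_gaugeAct ρ₀ v V

/-- The orbit average of a MEASURABLE real function is measurable (the action map is jointly measurable; Mathlib's `StronglyMeasurable.integral_prod_right'`).
[cite: Balaban1985Averaging, (12) p.19] -/
theorem measurable_orbAvg {ρ₀ : GaugeField P j (Matrix.specialUnitaryGroup (Fin N) ℂ) → ℝ} (hρ₀ : Measurable ρ₀) : Measurable (orbAvg ρ₀) := by
  have hF : StronglyMeasurable fun p : (Site P j → Matrix.specialUnitaryGroup (Fin N) ℂ) × GaugeField P j (Matrix.specialUnitaryGroup (Fin N) ℂ) =>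
      ρ₀ (GaugeField.gaugeAct p.1 p.2) :=
    (hρ₀.comp measurable_gaugeAct_uncurry).stronglyMeasurable
  exact (hF.integral_prod_left' (μ := haarTransf (N := N) P j)).measurable

/-- ★ **THE Γ-AVERAGED CANONICAL VERSION OF A MEASURABLE FUNCTION IS MEASURABLE** (a version continuous on the open maximal regular set glued with the measurable
`orbAvg ρ₀` off it). [cite: Balaban1987RG1, (0.13) p.254] -/
theorem measurable_canonVersion_orbAvg {ρ₀ : GaugeField P j (Matrix.specialUnitaryGroup (Fin N) ℂ) → ℝ} (hρ₀ : Measurable ρ₀) :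
    Measurable (canonVersion (fieldMeasure P j (Matrix.specialUnitaryGroup (Fin N) ℂ)) (orbAvg ρ₀)) := by
  classical
  haveI : SecondCountableTopology (GaugeField P j (Matrix.specialUnitaryGroup (Fin N) ℂ)) := T3OrbitAverage.instSecondCountableGaugeField
  haveI : BorelSpace (GaugeField P j (Matrix.specialUnitaryGroup (Fin N) ℂ)) := T3OrbitAverage.instBorelSpaceGaugeField
  have hm := measurable_orbAvg (N := N) hρ₀
  unfold canonVersion Node00.contVersionOn
  split_ifs with h
  · exact measurable_piecewise_of_continuousOn (s := regSet (fieldMeasure P j (Matrix.specialUnitaryGroup (Fin N) ℂ)) (orbAvg ρ₀))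
      isOpen_regSet h.choose_spec.1 hm
  · exact hm

/-- ★ **IT IS A VERSION**: if `ρ₀` is a.e.-strongly measurable and a.e. invariant under every gauge transformation, `canonVersion dU (orbAvg ρ₀) = ρ₀` `dU`-a.e.
(Node00 ✓`orbAvg_ae_eq_of_ae_invariant'` then ✓`canonVersion_ae_eq`). [cite: Balaban1987RG1, (0.13) p.254] -/
theorem canonVersion_orbAvg_ae_eq {ρ₀ : GaugeField P j (Matrix.specialUnitaryGroup (Fin N) ℂ) → ℝ}
    (hρ₀ : AEStronglyMeasurable ρ₀ (fieldMeasure P j (Matrix.specialUnitaryGroup (Fin N) ℂ)))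
    (hinv : ∀ γ : Site P j → Matrix.specialUnitaryGroup (Fin N) ℂ,
      (fun V => ρ₀ (GaugeField.gaugeAct γ V)) =ᵐ[fieldMeasure P j (Matrix.specialUnitaryGroup (Fin N) ℂ)] ρ₀) :
    canonVersion (fieldMeasure P j (Matrix.specialUnitaryGroup (Fin N) ℂ)) (orbAvg ρ₀)
      =ᵐ[fieldMeasure P j (Matrix.specialUnitaryGroup (Fin N) ℂ)] ρ₀ :=
  (canonVersion_ae_eq (μ := fieldMeasure P j (Matrix.specialUnitaryGroup (Fin N) ℂ))).trans (orbAvg_ae_eq_of_ae_invariant' hρ₀ hinv)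

/-- ★ **THE DENSITY OF A GAUGE-INVARIANT LAW IS A.E. GAUGE INVARIANT**: if `dU.withDensity (ofReal ∘ ρ₀)` (`ρ₀ ≥ 0` measurable) is invariant under a gauge
transformation `γ`, then `ρ₀(V^γ) = ρ₀(V)` for `dU`-a.e. `V` (§0 with `Φ = (·)^γ`, `Ψ = (·)^{γ⁻¹}`, product Haar is gauge invariant ✓`measurePreserving_gaugeAct`;
`ofReal` is injective on `[0, ∞)`). [cite: Balaban1985Averaging, (12)-(13) p.19] -/
theorem comp_gaugeAct_ae_eq_of_map_withDensity_eq {ρ₀ : GaugeField P j (Matrix.specialUnitaryGroup (Fin N) ℂ) → ℝ} (hρ₀m : Measurable ρ₀)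
    (hρ₀0 : ∀ V, 0 ≤ ρ₀ V) (γ : Site P j → Matrix.specialUnitaryGroup (Fin N) ℂ)
    (hlaw : ((fieldMeasure P j (Matrix.specialUnitaryGroup (Fin N) ℂ)).withDensity (fun V => ENNReal.ofReal (ρ₀ V))).map (GaugeField.gaugeAct γ) =
      (fieldMeasure P j (Matrix.specialUnitaryGroup (Fin N) ℂ)).withDensity (fun V => ENNReal.ofReal (ρ₀ V))) :
    (fun V => ρ₀ (GaugeField.gaugeAct γ V)) =ᵐ[fieldMeasure P j (Matrix.specialUnitaryGroup (Fin N) ℂ)] ρ₀ := by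
  have h := comp_ae_eq_of_map_withDensity_eq (μ := fieldMeasure P j (Matrix.specialUnitaryGroup (Fin N) ℂ))
    (measurable_gaugeAct γ) (measurable_gaugeAct (invTransf γ)) (measurePreserving_gaugeAct γ) (gaugeAct_inv_gaugeAct γ)
    (ENNReal.measurable_ofReal.comp hρ₀m) hlaw
  filter_upwards [h] with V hV
  have hV' : ENNReal.ofReal (ρ₀ (GaugeField.gaugeAct γ V)) = ENNReal.ofReal (ρ₀ V) := hV
  exact (ENNReal.ofReal_eq_ofReal_iff (hρ₀0 _) (hρ₀0 _)).1 hV'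

/-- ★ **(w) IS KEPT**: the Γ-averaged canonical version is a density of the SAME law — `dU.withDensity (ofReal ∘ canonVersion dU (orbAvg ρ₀)) = dU.withDensity (ofReal ∘ ρ₀)`
whenever the latter is invariant under every gauge transformation (`ρ₀ ≥ 0` measurable). [cite: Balaban1985Averaging, (10) and (12)-(13) p.19] -/
theorem withDensity_canonVersion_orbAvg_eq {ρ₀ : GaugeField P j (Matrix.specialUnitaryGroup (Fin N) ℂ) → ℝ} (hρ₀m : Measurable ρ₀)
    (hρ₀0 : ∀ V, 0 ≤ ρ₀ V)
    (hlaw : ∀ γ : Site P j → Matrix.specialUnitaryGroup (Fin N) ℂ,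
      ((fieldMeasure P j (Matrix.specialUnitaryGroup (Fin N) ℂ)).withDensity (fun V => ENNReal.ofReal (ρ₀ V))).map (GaugeField.gaugeAct γ) =
        (fieldMeasure P j (Matrix.specialUnitaryGroup (Fin N) ℂ)).withDensity (fun V => ENNReal.ofReal (ρ₀ V))) :
    (fieldMeasure P j (Matrix.specialUnitaryGroup (Fin N) ℂ)).withDensity
        (fun V => ENNReal.ofReal (canonVersion (fieldMeasure P j (Matrix.specialUnitaryGroup (Fin N) ℂ)) (orbAvg ρ₀) V)) =
      (fieldMeasure P j (Matrix.specialUnitaryGroup (Fin N) ℂ)).withDensity (fun V => ENNReal.ofReal (ρ₀ V)) := by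
  refine withDensity_congr_ae ?_
  filter_upwards [canonVersion_orbAvg_ae_eq hρ₀m.aestronglyMeasurable
    (fun γ => comp_gaugeAct_ae_eq_of_map_withDensity_eq hρ₀m hρ₀0 γ (hlaw γ))] with V hV
  rw [hV]

/-- ★ **NON-NEGATIVITY IS KEPT AT EVERY POINT** (`ρ₀ ≥ 0` measurable): off the maximal regular set the version IS `orbAvg ρ₀ ≥ 0` (an integral of non-negative values); on it the
version is continuous and a.e. equal to `orbAvg ρ₀ ≥ 0`, hence `≥ 0` by §0's a.e. ⇒ pointwise. [cite: Balaban1989LargeFieldI, p.176] -/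
theorem canonVersion_orbAvg_nonneg {ρ₀ : GaugeField P j (Matrix.specialUnitaryGroup (Fin N) ℂ) → ℝ} (hρ₀0 : ∀ V, 0 ≤ ρ₀ V)
    (V : GaugeField P j (Matrix.specialUnitaryGroup (Fin N) ℂ)) :
    0 ≤ canonVersion (fieldMeasure P j (Matrix.specialUnitaryGroup (Fin N) ℂ)) (orbAvg ρ₀) V := by
  haveI : (fieldMeasure P j (Matrix.specialUnitaryGroup (Fin N) ℂ)).IsOpenPosMeasure := isOpenPosMeasure_fieldMeasure_SU N P j
  haveI : SecondCountableTopology (GaugeField P j (Matrix.specialUnitaryGroup (Fin N) ℂ)) := T3OrbitAverage.instSecondCountableGaugeField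
  haveI : BorelSpace (GaugeField P j (Matrix.specialUnitaryGroup (Fin N) ℂ)) := T3OrbitAverage.instBorelSpaceGaugeField
  have horb : ∀ W, 0 ≤ orbAvg ρ₀ W := fun W => integral_nonneg fun γ => hρ₀0 _
  by_cases hV : V ∈ regSet (fieldMeasure P j (Matrix.specialUnitaryGroup (Fin N) ℂ)) (orbAvg ρ₀)
  · refine le_on_of_ae_le_of_continuousOn (μ := fieldMeasure P j (Matrix.specialUnitaryGroup (Fin N) ℂ)) isOpen_regSet continuousOn_const
      continuousOn_canonVersion ?_ V hV
    filter_upwards [ae_restrict_of_ae (canonVersion_ae_eq (μ := fieldMeasure P j (Matrix.specialUnitaryGroup (Fin N) ℂ)) (f := orbAvg ρ₀))] with W hW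
    rw [hW]; exact horb W
  · rw [canonVersion_eq_of_not_mem hV]; exact horb V

/-- ★ **POINTWISE DETERMINACY ON EVERY OPEN SET CARRYING A CONTINUOUS REPRESENTATIVE**: if `g` is continuous on an open `U` and `g = ρ₀` a.e. on `U` (for instance the WREG ∕ chart
reading of the density on the window), then the Γ-averaged canonical version EQUALS `g` at EVERY point of `U` (`ρ₀` a.e.-strongly measurable and a.e. invariant).
[cite: Balaban1987RG1, (0.13) p.254 and (0.19) p.255] -/
theorem canonVersion_orbAvg_eqOn_of_continuousOn {ρ₀ : GaugeField P j (Matrix.specialUnitaryGroup (Fin N) ℂ) → ℝ}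
    (hρ₀ : AEStronglyMeasurable ρ₀ (fieldMeasure P j (Matrix.specialUnitaryGroup (Fin N) ℂ)))
    (hinv : ∀ γ : Site P j → Matrix.specialUnitaryGroup (Fin N) ℂ,
      (fun V => ρ₀ (GaugeField.gaugeAct γ V)) =ᵐ[fieldMeasure P j (Matrix.specialUnitaryGroup (Fin N) ℂ)] ρ₀)
    {U : Set (GaugeField P j (Matrix.specialUnitaryGroup (Fin N) ℂ))} (hU : IsOpen U) {g : GaugeField P j (Matrix.specialUnitaryGroup (Fin N) ℂ) → ℝ}
    (hg : ContinuousOn g U) (hae : g =ᵐ[(fieldMeasure P j (Matrix.specialUnitaryGroup (Fin N) ℂ)).restrict U] ρ₀) :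
    EqOn (canonVersion (fieldMeasure P j (Matrix.specialUnitaryGroup (Fin N) ℂ)) (orbAvg ρ₀)) g U := by
  haveI : (fieldMeasure P j (Matrix.specialUnitaryGroup (Fin N) ℂ)).IsOpenPosMeasure := isOpenPosMeasure_fieldMeasure_SU N P j
  haveI : SecondCountableTopology (GaugeField P j (Matrix.specialUnitaryGroup (Fin N) ℂ)) := T3OrbitAverage.instSecondCountableGaugeField
  haveI : BorelSpace (GaugeField P j (Matrix.specialUnitaryGroup (Fin N) ℂ)) := T3OrbitAverage.instBorelSpaceGaugeField
  exact canonVersion_eqOn_of_continuousOn (μ := fieldMeasure P j (Matrix.specialUnitaryGroup (Fin N) ℂ)) hU hg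
    (hae.trans (ae_restrict_of_ae (orbAvg_ae_eq_of_ae_invariant' hρ₀ hinv).symm))

/-- The maximal regular set is version-independent: that of the orbit average is that of `ρ₀` (`ρ₀` a.e.-strongly measurable and a.e. invariant).
[cite: Balaban1987RG1, (0.13) p.254] -/
theorem regSet_orbAvg_eq {ρ₀ : GaugeField P j (Matrix.specialUnitaryGroup (Fin N) ℂ) → ℝ}
    (hρ₀ : AEStronglyMeasurable ρ₀ (fieldMeasure P j (Matrix.specialUnitaryGroup (Fin N) ℂ)))
    (hinv : ∀ γ : Site P j → Matrix.specialUnitaryGroup (Fin N) ℂ,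
      (fun V => ρ₀ (GaugeField.gaugeAct γ V)) =ᵐ[fieldMeasure P j (Matrix.specialUnitaryGroup (Fin N) ℂ)] ρ₀) :
    regSet (fieldMeasure P j (Matrix.specialUnitaryGroup (Fin N) ℂ)) (orbAvg ρ₀) = regSet (fieldMeasure P j (Matrix.specialUnitaryGroup (Fin N) ℂ)) ρ₀ :=
  regSet_congr_ae (orbAvg_ae_eq_of_ae_invariant' hρ₀ hinv)

/-- ★ **(c) READ ON THE VERSION**: the Γ-averaged canonical version is CONTINUOUS ON the maximal regular set of `ρ₀` — in particular on every open set on which the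
a.e.-class of `ρ₀` has a continuous representative (WREG's currency `W ⊆ Node00.regSet dU ρ`). [cite: Balaban1987RG1, (0.13) p.254 and p.259] -/
theorem continuousOn_canonVersion_orbAvg {ρ₀ : GaugeField P j (Matrix.specialUnitaryGroup (Fin N) ℂ) → ℝ}
    (hρ₀ : AEStronglyMeasurable ρ₀ (fieldMeasure P j (Matrix.specialUnitaryGroup (Fin N) ℂ)))
    (hinv : ∀ γ : Site P j → Matrix.specialUnitaryGroup (Fin N) ℂ,
      (fun V => ρ₀ (GaugeField.gaugeAct γ V)) =ᵐ[fieldMeasure P j (Matrix.specialUnitaryGroup (Fin N) ℂ)] ρ₀) :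
    ContinuousOn (canonVersion (fieldMeasure P j (Matrix.specialUnitaryGroup (Fin N) ℂ)) (orbAvg ρ₀))
      (regSet (fieldMeasure P j (Matrix.specialUnitaryGroup (Fin N) ℂ)) ρ₀) := by
  haveI : (fieldMeasure P j (Matrix.specialUnitaryGroup (Fin N) ℂ)).IsOpenPosMeasure := isOpenPosMeasure_fieldMeasure_SU N P j
  haveI : SecondCountableTopology (GaugeField P j (Matrix.specialUnitaryGroup (Fin N) ℂ)) := T3OrbitAverage.instSecondCountableGaugeField
  haveI : BorelSpace (GaugeField P j (Matrix.specialUnitaryGroup (Fin N) ℂ)) := T3OrbitAverage.instBorelSpaceGaugeField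
  rw [← regSet_orbAvg_eq hρ₀ hinv]
  exact continuousOn_canonVersion

/-- ★ **A.E. LOWER BOUNDS BECOME POINTWISE** (UV3-NODE §69.2 δ7): on an open `U` inside the maximal regular set of `ρ₀`, a lower bound `f ≤ ρ₀` holding only `dU`-a.e. on `U` with
`f` continuous on `U` holds for the Γ-averaged canonical version AT EVERY POINT of `U`. [cite: Balaban1985UV3, (47) p.267] -/
theorem le_canonVersion_orbAvg_on {ρ₀ : GaugeField P j (Matrix.specialUnitaryGroup (Fin N) ℂ) → ℝ}
    (hρ₀ : AEStronglyMeasurable ρ₀ (fieldMeasure P j (Matrix.specialUnitaryGroup (Fin N) ℂ)))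
    (hinv : ∀ γ : Site P j → Matrix.specialUnitaryGroup (Fin N) ℂ,
      (fun V => ρ₀ (GaugeField.gaugeAct γ V)) =ᵐ[fieldMeasure P j (Matrix.specialUnitaryGroup (Fin N) ℂ)] ρ₀)
    {U : Set (GaugeField P j (Matrix.specialUnitaryGroup (Fin N) ℂ))} (hU : IsOpen U)
    (hUreg : U ⊆ regSet (fieldMeasure P j (Matrix.specialUnitaryGroup (Fin N) ℂ)) ρ₀)
    {f : GaugeField P j (Matrix.specialUnitaryGroup (Fin N) ℂ) → ℝ} (hf : ContinuousOn f U)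
    (hle : ∀ᵐ V ∂(fieldMeasure P j (Matrix.specialUnitaryGroup (Fin N) ℂ)).restrict U, f V ≤ ρ₀ V) :
    ∀ V ∈ U, f V ≤ canonVersion (fieldMeasure P j (Matrix.specialUnitaryGroup (Fin N) ℂ)) (orbAvg ρ₀) V := by
  haveI : (fieldMeasure P j (Matrix.specialUnitaryGroup (Fin N) ℂ)).IsOpenPosMeasure := isOpenPosMeasure_fieldMeasure_SU N P j
  haveI : SecondCountableTopology (GaugeField P j (Matrix.specialUnitaryGroup (Fin N) ℂ)) := T3OrbitAverage.instSecondCountableGaugeField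
  haveI : BorelSpace (GaugeField P j (Matrix.specialUnitaryGroup (Fin N) ℂ)) := T3OrbitAverage.instBorelSpaceGaugeField
  refine le_on_of_ae_le_of_continuousOn (μ := fieldMeasure P j (Matrix.specialUnitaryGroup (Fin N) ℂ)) hU hf
    ((continuousOn_canonVersion_orbAvg hρ₀ hinv).mono hUreg) ?_
  filter_upwards [hle, ae_restrict_of_ae (canonVersion_orbAvg_ae_eq hρ₀ hinv)] with V h1 h2
  rw [h2]; exact h1

/-- ★ **A.E. UPPER BOUNDS BECOME POINTWISE** (δ7, the (41) side): same with `ρ₀ ≤ g` a.e. on `U`, `g` continuous on `U`. [cite: Balaban1985UV3, (41) p.266] -/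
theorem canonVersion_orbAvg_le_on {ρ₀ : GaugeField P j (Matrix.specialUnitaryGroup (Fin N) ℂ) → ℝ}
    (hρ₀ : AEStronglyMeasurable ρ₀ (fieldMeasure P j (Matrix.specialUnitaryGroup (Fin N) ℂ)))
    (hinv : ∀ γ : Site P j → Matrix.specialUnitaryGroup (Fin N) ℂ,
      (fun V => ρ₀ (GaugeField.gaugeAct γ V)) =ᵐ[fieldMeasure P j (Matrix.specialUnitaryGroup (Fin N) ℂ)] ρ₀)
    {U : Set (GaugeField P j (Matrix.specialUnitaryGroup (Fin N) ℂ))} (hU : IsOpen U)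
    (hUreg : U ⊆ regSet (fieldMeasure P j (Matrix.specialUnitaryGroup (Fin N) ℂ)) ρ₀)
    {g : GaugeField P j (Matrix.specialUnitaryGroup (Fin N) ℂ) → ℝ} (hg : ContinuousOn g U)
    (hle : ∀ᵐ V ∂(fieldMeasure P j (Matrix.specialUnitaryGroup (Fin N) ℂ)).restrict U, ρ₀ V ≤ g V) :
    ∀ V ∈ U, canonVersion (fieldMeasure P j (Matrix.specialUnitaryGroup (Fin N) ℂ)) (orbAvg ρ₀) V ≤ g V := by
  haveI : (fieldMeasure P j (Matrix.specialUnitaryGroup (Fin N) ℂ)).IsOpenPosMeasure := isOpenPosMeasure_fieldMeasure_SU N P j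
  haveI : SecondCountableTopology (GaugeField P j (Matrix.specialUnitaryGroup (Fin N) ℂ)) := T3OrbitAverage.instSecondCountableGaugeField
  haveI : BorelSpace (GaugeField P j (Matrix.specialUnitaryGroup (Fin N) ℂ)) := T3OrbitAverage.instBorelSpaceGaugeField
  refine le_on_of_ae_le_of_continuousOn (μ := fieldMeasure P j (Matrix.specialUnitaryGroup (Fin N) ℂ)) hU
    ((continuousOn_canonVersion_orbAvg hρ₀ hinv).mono hUreg) hg ?_
  filter_upwards [hle, ae_restrict_of_ae (canonVersion_orbAvg_ae_eq hρ₀ hinv)] with V h1 h2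
  rw [h2]; exact h1

/-- ★ **(p) READ ON THE VERSION**: a continuous, strictly positive a.e.-minorant on an open `U` inside the maximal regular set (e.g. WREG's `Z⁻¹·heightDensityCan (histGood)` with
✓p819387's a.e. sandwich) makes the Γ-averaged canonical version STRICTLY POSITIVE at every point of `U`. [cite: Balaban1989LargeFieldI, p.176] -/
theorem canonVersion_orbAvg_pos_on {ρ₀ : GaugeField P j (Matrix.specialUnitaryGroup (Fin N) ℂ) → ℝ}
    (hρ₀ : AEStronglyMeasurable ρ₀ (fieldMeasure P j (Matrix.specialUnitaryGroup (Fin N) ℂ)))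
    (hinv : ∀ γ : Site P j → Matrix.specialUnitaryGroup (Fin N) ℂ,
      (fun V => ρ₀ (GaugeField.gaugeAct γ V)) =ᵐ[fieldMeasure P j (Matrix.specialUnitaryGroup (Fin N) ℂ)] ρ₀)
    {U : Set (GaugeField P j (Matrix.specialUnitaryGroup (Fin N) ℂ))} (hU : IsOpen U)
    (hUreg : U ⊆ regSet (fieldMeasure P j (Matrix.specialUnitaryGroup (Fin N) ℂ)) ρ₀)
    {f : GaugeField P j (Matrix.specialUnitaryGroup (Fin N) ℂ) → ℝ} (hf : ContinuousOn f U) (hfpos : ∀ V ∈ U, 0 < f V)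
    (hle : ∀ᵐ V ∂(fieldMeasure P j (Matrix.specialUnitaryGroup (Fin N) ℂ)).restrict U, f V ≤ ρ₀ V) :
    ∀ V ∈ U, 0 < canonVersion (fieldMeasure P j (Matrix.specialUnitaryGroup (Fin N) ℂ)) (orbAvg ρ₀) V :=
  fun V hV => (hfpos V hV).trans_le (le_canonVersion_orbAvg_on hρ₀ hinv hU hUreg hf hle V hV)

end Gauge

end Summit.QuantumFields.YangMills.Theorems.FluctuationComparisonRegPrIntLS1aInvariantVersion

end
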